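import Summits.BirchSwinnertonDyer.Rank1Residual.Partition.CornersThree
import Literature.NumberTheory.EllipticCurves.SkinnerUrban2014.SemistableCurvesProofs
import Literature.NumberTheory.EllipticCurves.SemistablePeuRamifieRamifiedPrime
import HarnessLib

/-!
# The strong partial theorem at a GOOD `3` for SEMISTABLE curves: three corners
# (cell `b2b-bsdres`, seat rmap-3 gen 4; RESIDUAL-MAP.md §S.2 row 'good ordinary, surjective @3' /
# §S.5 'what the headline theorem says at p = 3', ⟦g4⟧ stamps of 2026-08-21)

HONEST FRAMING (run/shared/lean/b2b/bsd-rank1-residual/, verbatim in every file): the goal of the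
cell is to DELETE the COMBINATION-SHAPED residual classes of the Birch–Swinnerton-Dyer formula for
ALL analytic-rank `≤ 1` elliptic curves over `ℚ` — "full BSD formula for every rank `≤ 1` curve in
class `C`" assembled STRICTLY from published theorems — so that the rank-`≤ 1` remainder becomes
exactly the CONSTRUCTION-SHAPED classes, which are TYPED (missing-input `Prop`s), NOT attempted.
This is not "finishing BSD". Nothing here is a Literature statement; NO named fact is introduced.

`Partition/CornersThree.lean` (rmap-3 gen 3) states the headline at `p = 3` with SEVEN corners for an
arbitrary curve (five at a good `3`: X10b, X1@3, X6@3 ∧ `r = 0`, X7@3, X8).  On a SEMISTABLE curve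
(square-free conductor, `Semistable W`) two of the five are EMPTY: X10b = `ClassX10 W 3 ∧ ¬ Surj W 3`
because an irreducible `E[3]` on a semistable curve at a good odd `3` is automatically (ram) — the
level-lowering-to-level-one argument (lit-su gen 4, `SkinnerUrban2014.ram_of_semistable_of_irr` at
`p = 3`, inlined below; binders: Modularity `exists_isNewformOf` and Ribet/Diamond level-lowering
`diamond1995_refinedSerre`, both published; Skinner–Urban 2014 Cor. 3.6.10 / Remark (a)) — and
X7@3 = `GoodSS W 3 ∧ ¬ Semistable W`
by definition.  So at a good `3` a semistable curve of analytic rank `≤ 1` satisfies `BSD(E,3)`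
unless it is in X1@3 (rational `3`-isogeny, anomalous, outside the `r = 0 ∧` GV-parity quadrant —
NEEDS Mazur's MC at type A / the Schneider certificate), in X6@3 with `r = 0` (supersingular,
`a_3 = 0` — NEEDS Kobayashi's MC lower bound; BSTW arXiv:2409.01350 announced, PRE) or in X8
(supersingular, `a_3 = ±3` — NEEDS Sprung's ♯/♭ MC).  Companion: `Partition/SemistableCurves.lean`
(lit-su gen 4: semistable curves at a good ORDINARY `p`, residual = X1, empty at `p ≥ 11`).
The PUB\* flags travel with the named facts as in `CornersThree.lean` (`hYZ`, `hJSW`, `hCGS`, `hKob`).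

References: RESIDUAL-MAP.md §S.2 / §S.5; `Partition/CornersThree.lean`; `Partition/SemistableCurves.lean`.
-/

namespace Summit.BirchSwinnertonDyer.Rank1Residual

open WeierstrassCurve Literature.NumberTheory.EllipticCurves
  Literature.NumberTheory.EllipticCurves.Rank1Residual Literature.NumberTheory.EllipticCurves.ModularForms
open scoped NumberField

section Curve

variable {W : WeierstrassCurve ℚ} [W.IsElliptic] [W.IsGloballyMinimal]

/-! ### Three corners at a good `3` on a semistable curve -/

/-- **The strong partial theorem at a GOOD `3` for SEMISTABLE curves: three corners.**  For every
globally minimal SEMISTABLE elliptic `W/ℚ` of analytic rank `≤ 1` with good reduction at `3`,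
`BSDp W 3` holds — granted the fourteen named published facts of the covered rows, Modularity
(`hBCDT`) and level-lowering (`hLL`) — unless `(W, 3)` is in X1@3, in X6@3 with `r = 0`, or in X8.
Proof: `bsdp_three_good_of_not_corner` with X10b emptied by Ribet's (ram) at `p = 3`
(`SkinnerUrban2014.ram_of_semistable_of_irr`, inlined) and X7 by `hsst`.
[cite: SkinnerUrban2014, Cor. 3.6.10 (p. 45) and Remark (a) (p. 46)] [folklore] -/
theorem bsdp_three_of_semistable_of_good_of_not_corner
    (hSk : Skinner2016.thmC_padicValRat_bsd_rank_zero)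
    (hBCS : BurungaleCastellaSkinner2025.cor131_padicValRat_bsd_rank_le_one)
    (hJSW : JetchevSkinnerWan2017.thm121_padicValRat_bsd_rank_one)
    (hCGS : CastellaGrossiSkinner2025.thmD_padicValRat_bsd_rank_le_one)
    (hGV : GreenbergVatsal2000.thm13_charIdeal_eq_of_gvPar) (hGr : greenberg_charValue_rankZero)
    (hmod : hasEntireLFunction_rat) (hmodP : nonempty_modularParametrizationData)
    (hGZK : rank_eq_analyticRank_of_analyticRank_le_one)
    (hCM : bsdTriple_of_hasCM_of_L_one_ne_zero) (hKob : Kobayashi2013.cor14_bsdp_of_cm_rank_one)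
    (hYZ : YanZhu2026.thm415_padicValRat_bsd_rank_le_one)
    (hW20 : Wuthrich2014.lemma20_surjective_threeAdic_of_semistable)
    (hLLT : LiLiuTian2024.thm11_bsdp_of_cm_rank_one)
    (hBCDT : exists_isNewformOf) (hLL : Literature.NumberTheory.Automorphic.diamond1995_refinedSerre)
    (hr : W.analyticRank ≤ 1) (hsst : Semistable W) (hgood : Good W 3)
    (hX1 : ¬ ClassX1 W 3) (hX6 : ¬ (ClassX6 W 3 ∧ W.analyticRank = 0)) (hX8 : ¬ ClassX8 W 3) :
    BSDp W 3 :=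
  bsdp_three_good_of_not_corner hSk hBCS hJSW hCGS hGV hGr hmod hmodP hGZK hCM hKob hYZ hW20 hLLT hr
    hgood (fun h10 ↦ by
      obtain ⟨-, hord3, hirr3, h3⟩ := h10.1
      rcases h3 with ⟨-, hnr⟩ | ⟨-, hns⟩
      · exact hnr
          (SkinnerUrban2014.ram_of_semistable_of_irr hBCDT hLL W 3 (by decide) hord3.1 hsst hirr3)
      · exact hns hsst) hX1 hX6
    (fun h7 ↦ h7.2 hsst) hX8

/-- **The partition at a good `3` for SEMISTABLE curves**: `BSD(E,3)`, or one of the THREE named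
decidable cells X1@3 / X6@3 ∧ `r = 0` / X8.  (Compare `bsdp_three_or_cell`: eleven cells for an
arbitrary curve and arbitrary reduction at `3`.) [folklore] -/
theorem bsdp_three_or_cell_of_semistable_of_good
    (hSk : Skinner2016.thmC_padicValRat_bsd_rank_zero)
    (hBCS : BurungaleCastellaSkinner2025.cor131_padicValRat_bsd_rank_le_one)
    (hJSW : JetchevSkinnerWan2017.thm121_padicValRat_bsd_rank_one)
    (hCGS : CastellaGrossiSkinner2025.thmD_padicValRat_bsd_rank_le_one)
    (hGV : GreenbergVatsal2000.thm13_charIdeal_eq_of_gvPar) (hGr : greenberg_charValue_rankZero)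
    (hmod : hasEntireLFunction_rat) (hmodP : nonempty_modularParametrizationData)
    (hGZK : rank_eq_analyticRank_of_analyticRank_le_one)
    (hCM : bsdTriple_of_hasCM_of_L_one_ne_zero) (hKob : Kobayashi2013.cor14_bsdp_of_cm_rank_one)
    (hYZ : YanZhu2026.thm415_padicValRat_bsd_rank_le_one)
    (hW20 : Wuthrich2014.lemma20_surjective_threeAdic_of_semistable)
    (hLLT : LiLiuTian2024.thm11_bsdp_of_cm_rank_one)
    (hBCDT : exists_isNewformOf) (hLL : Literature.NumberTheory.Automorphic.diamond1995_refinedSerre)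
    (hr : W.analyticRank ≤ 1) (hsst : Semistable W) (hgood : Good W 3) :
    BSDp W 3 ∨ (ClassX1 W 3 ∨ (ClassX6 W 3 ∧ W.analyticRank = 0) ∨ ClassX8 W 3) := by
  by_cases h1 : ClassX1 W 3
  · exact Or.inr (Or.inl h1)
  by_cases h6 : ClassX6 W 3 ∧ W.analyticRank = 0
  · exact Or.inr (Or.inr (Or.inl h6))
  by_cases h8 : ClassX8 W 3
  · exact Or.inr (Or.inr (Or.inr h8))
  exact Or.inl (bsdp_three_of_semistable_of_good_of_not_corner hSk hBCS hJSW hCGS hGV hGr hmod hmodP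
    hGZK hCM hKob hYZ hW20 hLLT hBCDT hLL hr hsst hgood h1 h6 h8)

/-- **Semistable, analytic rank ONE, good `3`, `E[3]` irreducible, and `a_3 = 0` if `3` is
supersingular ⇒ `BSD(E,3)`** — the shape of Jetchev–Skinner–Wan 2017 Thm 1.2.1 at `p = 3`
("If p = 3 then (1.2) holds provided a_p(E) = 0 when E has supersingular reduction at p") merged
with the ordinary row: X1 needs `E[3]` reducible, the X6 corner is rank `0` only, and X8 is
excluded by the `a_3 = 0` proviso.  No corner hypothesis is left. [cite: JetchevSkinnerWan2017,
Thm. 1.2.1] [folklore] -/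
theorem bsdp_three_of_semistable_of_good_of_irr_rankOne
    (hSk : Skinner2016.thmC_padicValRat_bsd_rank_zero)
    (hBCS : BurungaleCastellaSkinner2025.cor131_padicValRat_bsd_rank_le_one)
    (hJSW : JetchevSkinnerWan2017.thm121_padicValRat_bsd_rank_one)
    (hCGS : CastellaGrossiSkinner2025.thmD_padicValRat_bsd_rank_le_one)
    (hGV : GreenbergVatsal2000.thm13_charIdeal_eq_of_gvPar) (hGr : greenberg_charValue_rankZero)
    (hmod : hasEntireLFunction_rat) (hmodP : nonempty_modularParametrizationData)
    (hGZK : rank_eq_analyticRank_of_analyticRank_le_one)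
    (hCM : bsdTriple_of_hasCM_of_L_one_ne_zero) (hKob : Kobayashi2013.cor14_bsdp_of_cm_rank_one)
    (hYZ : YanZhu2026.thm415_padicValRat_bsd_rank_le_one)
    (hW20 : Wuthrich2014.lemma20_surjective_threeAdic_of_semistable)
    (hLLT : LiLiuTian2024.thm11_bsdp_of_cm_rank_one)
    (hBCDT : exists_isNewformOf) (hLL : Literature.NumberTheory.Automorphic.diamond1995_refinedSerre)
    (hr1 : W.analyticRank = 1) (hsst : Semistable W) (hgood : Good W 3) (hirr : Irr W 3)
    (ha3 : GoodSS W 3 → W.frobeniusTrace 3 = 0) : BSDp W 3 :=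
  bsdp_three_of_semistable_of_good_of_not_corner hSk hBCS hJSW hCGS hGV hGr hmod hmodP hGZK hCM hKob
    hYZ hW20 hLLT hBCDT hLL (by omega) hsst hgood (fun h1 ↦ h1.2.1 hirr) (fun h6 ↦ by omega)
    (fun h8 ↦ h8.2.2 (ha3 h8.2.1))


/-! ### Any reduction at `3` on a semistable curve: six cells (rmap-3 gen 4, second pass) -/

omit [W.IsElliptic] [W.IsGloballyMinimal] in
/-- A semistable curve has no additive prime. [folklore] -/
theorem not_addv_of_semistable (hsst : Semistable W) (p : ℕ) [hp : Fact p.Prime] : ¬ Addv W p :=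
  fun hadd ↦ by
    rcases hsst p hp.out with h | h
    · exact hadd.1 h
    · exact hadd.2 h

/-- **The partition at `3` for SEMISTABLE curves, any reduction at `3`**: `BSD(E,3)`, or one of SIX
named decidable cells — X1@3 (good `3`, rational `3`-isogeny corner), X6@3 ∧ `r = 0`, X8
(supersingular `3`), X11a@3 (`3 ‖ N`, `r = 0`, irreducible, no second multiplicative prime ramified
in `E[3]`), X2@3 (`3 ‖ N`, rational `3`-isogeny), X11b@3 (`3 ‖ N`, `r = 1`, irreducible).  Of the
eleven cells of `bsdp_three_or_cell` five are EMPTY on a semistable curve: X10b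
(Ribet's (ram) at `3`, `SkinnerUrban2014.ram_of_semistable_of_irr`), X7@3 (definition), X3@3 / X4@3 (additive `3`)
and the CM corner `CornerF` (a CM curve over `ℚ` is never semistable,
`Rank1Residual.not_semistable_of_hasCM`).  RESIDUAL-MAP.md §S.2 / §S.5. [folklore] -/
theorem bsdp_three_or_cell_of_semistable
    (hSk : Skinner2016.thmC_padicValRat_bsd_rank_zero)
    (hBCS : BurungaleCastellaSkinner2025.cor131_padicValRat_bsd_rank_le_one)
    (hJSW : JetchevSkinnerWan2017.thm121_padicValRat_bsd_rank_one)
    (hCGS : CastellaGrossiSkinner2025.thmD_padicValRat_bsd_rank_le_one)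
    (hGV : GreenbergVatsal2000.thm13_charIdeal_eq_of_gvPar) (hGr : greenberg_charValue_rankZero)
    (hmod : hasEntireLFunction_rat) (hmodP : nonempty_modularParametrizationData)
    (hGZK : rank_eq_analyticRank_of_analyticRank_le_one)
    (hCM : bsdTriple_of_hasCM_of_L_one_ne_zero) (hKob : Kobayashi2013.cor14_bsdp_of_cm_rank_one)
    (hYZ : YanZhu2026.thm415_padicValRat_bsd_rank_le_one)
    (hW20 : Wuthrich2014.lemma20_surjective_threeAdic_of_semistable)
    (hLLT : LiLiuTian2024.thm11_bsdp_of_cm_rank_one)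
    (hBCDT : exists_isNewformOf) (hLL : Literature.NumberTheory.Automorphic.diamond1995_refinedSerre)
    (hr : W.analyticRank ≤ 1) (hsst : Semistable W) :
    BSDp W 3 ∨
      (ClassX1 W 3 ∨ (ClassX6 W 3 ∧ W.analyticRank = 0) ∨ ClassX8 W 3 ∨ ClassX11a W 3 ∨
        ClassX2 W 3 ∨ ClassX11b W 3) := by
  rcases bsdp_three_or_cell hSk hBCS hJSW hCGS hGV hGr hmod hmodP hGZK hCM hKob hYZ hW20 hLLT hr with
    h | h10 | h1 | h6 | h7 | h8 | h11a | h2 | h3 | h4 | h11b | hF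
  · exact Or.inl h
  · obtain ⟨-, hord3, hirr3, h3⟩ := h10.1
    rcases h3 with ⟨-, hnr⟩ | ⟨-, hns⟩
    · exact absurd
        (SkinnerUrban2014.ram_of_semistable_of_irr hBCDT hLL W 3 (by decide) hord3.1 hsst hirr3) hnr
    · exact absurd hsst hns
  · exact Or.inr (Or.inl h1)
  · exact Or.inr (Or.inr (Or.inl h6))
  · exact absurd hsst h7.2
  · exact Or.inr (Or.inr (Or.inr (Or.inl h8)))
  · exact Or.inr (Or.inr (Or.inr (Or.inr (Or.inl h11a))))
  · exact Or.inr (Or.inr (Or.inr (Or.inr (Or.inr (Or.inl h2)))))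
  · exact absurd h3.2 (not_addv_of_semistable hsst 3)
  · exact absurd h4.2.1 (not_addv_of_semistable hsst 3)
  · exact Or.inr (Or.inr (Or.inr (Or.inr (Or.inr (Or.inr h11b)))))
  · exact absurd hsst (Rank1Residual.not_semistable_of_hasCM W hF.1)


/-! ### The multiplicative `3` on a semistable curve: (ram) is automatic (rmap-3 gen 4, third pass)

`Literature/NumberTheory/EllipticCurves/SemistablePeuRamifieRamifiedPrime.lean` (rmap-3 gen 4)
proves `ram_three_of_semistable_of_irr`: EVERY semistable `E/ℚ` with `E[3]` irreducible has a
prime `ℓ ‖ N`, `ℓ ≠ 3`, with `3 ∤ ord_ℓ(Δ_min)` — Ribet's level-lowering to level one, closed off by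
Serre's bound `k(ρ̄) ≤ p² − 1 = 8` and `S_k(SL₂(ℤ)) = 0` for `k < 12` (no très/peu ramifié analysis
at `3` is needed).  Consequences at `3` for SEMISTABLE curves: the rank-`0` multiplicative corner
X11a@3 (`3 ‖ N`, `E[3]` irreducible, NO (ram) witness) is EMPTY, so `BSD(E,3)` holds in analytic
rank `0` at a multiplicative `3` with `E[3]` irreducible by Skinner 2016 Thm. C (row C1) with NO
corner hypothesis; and the semistable partition at `3` loses one more cell (FIVE cells).  At any
odd `p` the same file gives the peu ramifié case (`ram_of_semistable_of_irr_of_mult_of_dvd`,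
`p ∣ ord_p(Δ_min)`).  Data (rmap-3 gen 4, Cremona `N < 5·10⁵`, semistable classes): 298 932 /
298 932 pairs `(E, 3)` with `3 ‖ N` and `E[3]` irreducible have a (ram) witness; at `p ∈ {5, 7}`
likewise 208 769 / 155 218 (a kernel theorem for `p ≤ 7`: `ram_of_semistable_of_irr_of_le_seven`,
Serre's weight `≤ p + 1 ≤ 8` at a semistable `p`; see the last section); the first
(ram)-free irreducible semistable pairs are `11a1 @ 11`, `17a1 @ 17`, `19a1 @ 19`, `37a1 @ 37`. -/

/-- **X11a is EMPTY at `3` on semistable curves.** [folklore] -/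
theorem not_classX11a_three_of_semistable (hBCDT : exists_isNewformOf)
    (hLL : Literature.NumberTheory.Automorphic.diamond1995_refinedSerre) (hsst : Semistable W) :
    ¬ ClassX11a W 3 := fun h ↦
  h.2.2.2.2 (Literature.NumberTheory.EllipticCurves.ram_three_of_semistable_of_irr hBCDT hLL W hsst
    h.2.2.2.1)

/-- **X11a at an odd peu ramifié multiplicative `p` is EMPTY on semistable curves**
(`p ∣ ord_p(Δ_min)`). [folklore] -/
theorem not_classX11a_of_semistable_of_dvd (hBCDT : exists_isNewformOf)
    (hLL : Literature.NumberTheory.Automorphic.diamond1995_refinedSerre) {p : ℕ} [Fact p.Prime]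
    (hsst : Semistable W) (hpeu : p ∣ padicValInt p W.minimalDiscriminantInt) : ¬ ClassX11a W p :=
  fun h ↦ h.2.2.2.2 (Literature.NumberTheory.EllipticCurves.ram_of_semistable_of_irr_of_mult_of_dvd
    hBCDT hLL W p h.2.1 h.2.2.1 hpeu hsst h.2.2.2.1)

/-- **`BSD(E,3)` for a SEMISTABLE curve of analytic rank `0` at a MULTIPLICATIVE `3` with `E[3]`
irreducible — corner-free**: Skinner 2016 Thm. C (row C1: `hSk`, with Kato's divisibility inside the
named fact) whose hypothesis (ram) is DISCHARGED by `ram_three_of_semistable_of_irr` (Modularity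
`hBCDT` + level-lowering `hLL`).  RESIDUAL-MAP.md §S.2 row '§C multiplicative, irreducible' at `3`.
[cite: Skinner2016PacificMC, Thm. C] [cite: Ribet1990, Thm. 1.1] -/
theorem bsdp_three_of_semistable_of_mult_of_irr_rankZero
    (hSk : Skinner2016.thmC_padicValRat_bsd_rank_zero) (hmod : hasEntireLFunction_rat)
    (hGZK : rank_eq_analyticRank_of_analyticRank_le_one) (hBCDT : exists_isNewformOf)
    (hLL : Literature.NumberTheory.Automorphic.diamond1995_refinedSerre)
    (hr0 : W.analyticRank = 0) (hsst : Semistable W) (hm : Mult W 3) (hirr : Irr W 3) : BSDp W 3 :=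
  bsdp_mult_rankZero_of_irr_of_ram hSk hmod hGZK (by decide) hm hr0 hirr
    (Literature.NumberTheory.EllipticCurves.ram_three_of_semistable_of_irr hBCDT hLL W hsst hirr)

/-- **`BSD(E,p)` for a SEMISTABLE curve of analytic rank `0` at an odd peu ramifié MULTIPLICATIVE `p`
(`p ∣ ord_p(Δ_min)`) with `E[p]` irreducible — corner-free** (row C1 with (ram) discharged by
`ram_of_semistable_of_irr_of_mult_of_dvd`). [cite: Skinner2016PacificMC, Thm. C]
[cite: Ribet1990, Thm. 1.1] -/
theorem bsdp_of_semistable_of_mult_of_dvd_of_irr_rankZero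
    (hSk : Skinner2016.thmC_padicValRat_bsd_rank_zero) (hmod : hasEntireLFunction_rat)
    (hGZK : rank_eq_analyticRank_of_analyticRank_le_one) (hBCDT : exists_isNewformOf)
    (hLL : Literature.NumberTheory.Automorphic.diamond1995_refinedSerre) {p : ℕ} [Fact p.Prime]
    (hr0 : W.analyticRank = 0) (hp2 : p ≠ 2) (hsst : Semistable W) (hm : Mult W p)
    (hpeu : p ∣ padicValInt p W.minimalDiscriminantInt) (hirr : Irr W p) : BSDp W p :=
  bsdp_mult_rankZero_of_irr_of_ram hSk hmod hGZK hp2 hm hr0 hirr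
    (Literature.NumberTheory.EllipticCurves.ram_of_semistable_of_irr_of_mult_of_dvd hBCDT hLL W p hp2
      hm hpeu hsst hirr)

/-- **The partition at `3` for SEMISTABLE curves — FIVE cells**: `BSD(E,3)`, or X1@3 / X6@3 ∧ `r = 0`
/ X8 (the good-`3` corners) / X2@3 (rational `3`-isogeny at a multiplicative `3`) / X11b@3
(`3 ‖ N`, `r = 1`, irreducible).  X11a@3 has joined X10b, X7, X3, X4 and the CM corner among the
cells that are EMPTY on a semistable curve (`not_classX11a_three_of_semistable`).
RESIDUAL-MAP.md §S.2 / §S.5 / §S.8. [folklore] -/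
theorem bsdp_three_or_cell_of_semistable'
    (hSk : Skinner2016.thmC_padicValRat_bsd_rank_zero)
    (hBCS : BurungaleCastellaSkinner2025.cor131_padicValRat_bsd_rank_le_one)
    (hJSW : JetchevSkinnerWan2017.thm121_padicValRat_bsd_rank_one)
    (hCGS : CastellaGrossiSkinner2025.thmD_padicValRat_bsd_rank_le_one)
    (hGV : GreenbergVatsal2000.thm13_charIdeal_eq_of_gvPar) (hGr : greenberg_charValue_rankZero)
    (hmod : hasEntireLFunction_rat) (hmodP : nonempty_modularParametrizationData)
    (hGZK : rank_eq_analyticRank_of_analyticRank_le_one)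
    (hCM : bsdTriple_of_hasCM_of_L_one_ne_zero) (hKob : Kobayashi2013.cor14_bsdp_of_cm_rank_one)
    (hYZ : YanZhu2026.thm415_padicValRat_bsd_rank_le_one)
    (hW20 : Wuthrich2014.lemma20_surjective_threeAdic_of_semistable)
    (hLLT : LiLiuTian2024.thm11_bsdp_of_cm_rank_one)
    (hBCDT : exists_isNewformOf) (hLL : Literature.NumberTheory.Automorphic.diamond1995_refinedSerre)
    (hr : W.analyticRank ≤ 1) (hsst : Semistable W) :
    BSDp W 3 ∨
      (ClassX1 W 3 ∨ (ClassX6 W 3 ∧ W.analyticRank = 0) ∨ ClassX8 W 3 ∨ ClassX2 W 3 ∨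
        ClassX11b W 3) := by
  rcases bsdp_three_or_cell_of_semistable hSk hBCS hJSW hCGS hGV hGr hmod hmodP hGZK hCM hKob hYZ hW20
      hLLT hBCDT hLL hr hsst with h | h1 | h6 | h8 | h11a | h2 | h11b
  · exact Or.inl h
  · exact Or.inr (Or.inl h1)
  · exact Or.inr (Or.inr (Or.inl h6))
  · exact Or.inr (Or.inr (Or.inr (Or.inl h8)))
  · exact absurd h11a (not_classX11a_three_of_semistable hBCDT hLL hsst)
  · exact Or.inr (Or.inr (Or.inr (Or.inr (Or.inl h2))))
  · exact Or.inr (Or.inr (Or.inr (Or.inr (Or.inr h11b))))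

/-- **Rank `0`, semistable, `3` good or multiplicative, `E[3]` irreducible, `a_3 = 0` excluded at a
supersingular `3` ⇒ `BSD(E,3)`** — at `3` good ordinary this is lit-su's cell, at `3` supersingular
with `a_3 = ±3` it is the X8 corner (excluded by `ha3`), at `3` supersingular with `a_3 = 0` the X6
rank-`0` corner (excluded by `hss`), at `3` multiplicative the corner-free theorem above.  Stated for
the record as the sharpest rank-`0` sentence at `3` on semistable curves: the only inputs beyond the
published facts are irreducibility of `E[3]` and '`3` not supersingular'. [folklore] -/
theorem bsdp_three_of_semistable_of_irr_of_not_goodSS_rankZero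
    (hSk : Skinner2016.thmC_padicValRat_bsd_rank_zero)
    (hBCS : BurungaleCastellaSkinner2025.cor131_padicValRat_bsd_rank_le_one)
    (hJSW : JetchevSkinnerWan2017.thm121_padicValRat_bsd_rank_one)
    (hCGS : CastellaGrossiSkinner2025.thmD_padicValRat_bsd_rank_le_one)
    (hGV : GreenbergVatsal2000.thm13_charIdeal_eq_of_gvPar) (hGr : greenberg_charValue_rankZero)
    (hmod : hasEntireLFunction_rat) (hmodP : nonempty_modularParametrizationData)
    (hGZK : rank_eq_analyticRank_of_analyticRank_le_one)
    (hCM : bsdTriple_of_hasCM_of_L_one_ne_zero) (hKob : Kobayashi2013.cor14_bsdp_of_cm_rank_one)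
    (hYZ : YanZhu2026.thm415_padicValRat_bsd_rank_le_one)
    (hW20 : Wuthrich2014.lemma20_surjective_threeAdic_of_semistable)
    (hLLT : LiLiuTian2024.thm11_bsdp_of_cm_rank_one)
    (hBCDT : exists_isNewformOf) (hLL : Literature.NumberTheory.Automorphic.diamond1995_refinedSerre)
    (hr0 : W.analyticRank = 0) (hsst : Semistable W) (hirr : Irr W 3) (hss : ¬ GoodSS W 3) :
    BSDp W 3 := by
  rcases bsdp_three_or_cell_of_semistable' hSk hBCS hJSW hCGS hGV hGr hmod hmodP hGZK hCM hKob hYZ hW20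
      hLLT hBCDT hLL (by omega) hsst with h | h1 | h6 | h8 | h2 | h11b
  · exact h
  · exact absurd hirr h1.2.1
  · exact absurd h6.1.1 hss
  · exact absurd h8.2.1 hss
  · exact absurd hirr h2.2.1
  · exact absurd h11b.1 (by omega)


/-! ## `p ∈ {3, 5, 7}`: the X11a cell is empty on semistable curves

`Literature…ram_of_semistable_of_irr_of_le_seven` (rmap-3 gen 4): at a semistable `p ∈ {3, 5, 7}`
Serre's weight of `E[p] ⊗ 𝔽̄_p` is `≤ p + 1 ≤ 8 < 12` (good: `2`; multiplicative peu ramifié: `2`;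
multiplicative très ramifié: `p + 1`), so the level-one argument that empties X11a at `3` runs at `5`
and `7` as well.  Consequences: `X11a@p ∩ semistable = ∅` for every `p ≤ 7`, and the corner-free
rank-`0` theorem at a multiplicative `p ∈ {3, 5, 7}`.  Sharp: `11a1 @ 11` lies in X11a
(`E[11] ≅ Δ mod 11`, weight `12`). -/

/-- **X11a is EMPTY at every `p ≤ 7` on semistable curves.** [folklore] -/
theorem not_classX11a_of_semistable_of_le_seven (hBCDT : exists_isNewformOf)
    (hLL : Literature.NumberTheory.Automorphic.diamond1995_refinedSerre) {p : ℕ} [Fact p.Prime]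
    (hp7 : p ≤ 7) (hsst : Semistable W) : ¬ ClassX11a W p := fun h ↦
  h.2.2.2.2 (Literature.NumberTheory.EllipticCurves.ram_of_semistable_of_irr_of_le_seven hBCDT hLL W
    p h.2.1 hp7 hsst h.2.2.2.1)

/-- **Rank `0`, semistable, `p ∈ {3, 5, 7}` multiplicative, `E[p]` irreducible ⇒ `BSD(E,p)` — NO
corner hypothesis** (Skinner 2016 Thm. C, its (ram) hypothesis discharged by
`ram_of_semistable_of_irr_of_le_seven`). [folklore] -/
theorem bsdp_of_semistable_of_mult_of_irr_rankZero_of_le_seven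
    (hSk : Skinner2016.thmC_padicValRat_bsd_rank_zero) (hmod : hasEntireLFunction_rat)
    (hGZK : rank_eq_analyticRank_of_analyticRank_le_one) (hBCDT : exists_isNewformOf)
    (hLL : Literature.NumberTheory.Automorphic.diamond1995_refinedSerre) {p : ℕ} [Fact p.Prime]
    (hr0 : W.analyticRank = 0) (hp2 : p ≠ 2) (hp7 : p ≤ 7) (hsst : Semistable W) (hm : Mult W p)
    (hirr : Irr W p) : BSDp W p :=
  bsdp_mult_rankZero_of_irr_of_ram hSk hmod hGZK hp2 hm hr0 hirr
    (Literature.NumberTheory.EllipticCurves.ram_of_semistable_of_irr_of_le_seven hBCDT hLL W p hp2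
      hp7 hsst hirr)

end Curve

end Summit.BirchSwinnertonDyer.Rank1Residual
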